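/-
Copyright (c) 2026 the pub-hodgecm-mathlib formalisation cell (harness21).  Prover seat hodgecm-mathlib-K2E3-p17 (g9), R90-S1 (section planner R90-C10-plan, deal (E3-2)
15:42:57Z): the split-place induction `n-Ind_{P(2,1)}(σ ⊠ χ′)` is irreducible when `σ` is an (irreducible) PRINCIPAL SERIES `I₂(ψ₁,ψ₂)` of the `GL₂`-block and no two of
`ψ₁, ψ₂, χ′` are linked — the principal-series case of socket S1#7.  2026-09-04.
-/
import Summits.HodgeConjecture.HodgeConjecture.Theorems.K2E3GL3InductionInStagesEquiv            -- ★ E2-I `exists_equiv_parabolicIndGL_twoOne_box` (`Ind_{P₂₁}(I(x,y) ⊠ z) ≅ I(x,y,z)`)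
import Summits.HodgeConjecture.HodgeConjecture.Theorems.K2E3GL3PrincipalSeriesIrreducibleUnlinked   -- ★ C0-IRR `isIrreducible_principalSeries_three_of_unlinked`
import Summits.HodgeConjecture.HodgeConjecture.Theorems.K2E3GL3UnitaryPrincipalSeriesIrregular      -- ★ IH-5 `isIrreducible_parabolicIndGL_id_three_self`
import Summits.HodgeConjecture.HodgeConjecture.Theorems.K2E3GL3PrincipalSeriesThreeCell            -- ★ (CELL-3) `principalSeriesThreeCell`
import Summits.HodgeConjecture.HodgeConjecture.Theorems.K2E3GL3MaximalParabolicRelabel             -- ★ `lastBlockLabel_three`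
import Literature.NumberTheory.Automorphic.ParabolicGLExactProofs                                  -- ★ `parabolicIndGLMap`, `parabolicIndGLMap_injective`, `parabolicIndGLMap_surjective`
import Literature.NumberTheory.Automorphic.IrreducibleClasses                                      -- ★ `Representation.Equiv.isIrreducible_iff`, `IsSmooth.twist`
import Literature.NumberTheory.Automorphic.ParabolicGLReindex                                      -- ★ `IsSmooth.comp_of_continuous`
import Literature.NumberTheory.Automorphic.Liu2021.LemD1SplitPlaceOfFacts                          -- ★ `isOpen_ker_of_continuous`
import HarnessLib

/-!
# R90-S1 (Rogawski §12.2, split places) — `n-Ind_{P_{(2,1)}}^{GL₃(F)}(σ ⊠ χ′)` IS IRREDUCIBLE FOR `σ ≅ I₂(ψ₁, ψ₂)` AN IRREDUCIBLE PRINCIPAL SERIES, NO LINKS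

Cell `hodgecm-mathlib`, R90-S1 (deal (E3-2) BY NAME to K2E3-p17 (g9), census 16:3xZ); THEOREMS ONLY; count-neutral helper (`--supports stmt-HodgeConjecture-24833 --as helper`);
rule R-S1-1: no `Lines` import; the head is spelled over ★ `parabolicIndGL F (Zelevinsky1980.lastBlockLabel 3) …` EXACTLY as socket S1#7 (`R90_S1_SplitLocalPacketsB.lean` :130–:143),
with `[CharZero F]` and, HYPOTHESIS-FIRST for road β's GL₂ dichotomy: a block equivalence `e : Fin 2 ≃ {i // lastBlockLabel 3 i = false}` (`↑(e j) = castSucc j`), characters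
`ψ₁, ψ₂` with open kernels, an equivalence `σ ≃ I₂(ψ₁,ψ₂) ∘ (reindexGL e)⁻¹` (★ E2-I's «box» currency) and the «no link» letters `ψ_j ≠ ψ_i·ν` among `(ψ₁, ψ₂, χ′)`
(★ C0-IRR's `hunl` shape; for unitarizable `σ` and unitary `χ′` road β discharges them: a link needs a ratio `‖·‖^{±1}`).

THE MATHEMATICS ([BernsteinZelevinsky1977, Prop. 1.9 (c), §2.3, Thm. 4.2]; [Zelevinsky1980, Thm. 4.2 p. 184]; [Rogawski1990, §4.13 p. 64, §13.3 p. 201]).  Induction in stages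
`Ind_{P(2,1)}(I₂(ψ₁,ψ₂) ⊠ χ′) ≅ I(ψ₁,ψ₂,χ′)` (★ E2-I `exists_equiv_parabolicIndGL_twoOne_box`, transported along `σ ≅ I₂(ψ₁,ψ₂)` by the exact functor `i_{P(2,1)}` ★
`parabolicIndGLMap_injective ∕ _surjective`); the principal series `I(ψ₁,ψ₂,χ′)` of `GL₃(F)` is irreducible when no two of its letters are linked: ★ C0-IRR
`isIrreducible_principalSeries_three_of_unlinked` (pairwise unlinked, not all equal; the weak 3-cell lemma ★ (CELL-3) supplies `h3cell`, `[CharZero F]`) and ★ IH-5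
`isIrreducible_parabolicIndGL_id_three_self` (all three equal).  The labelling `lastBlockLabel 3` of the socket equals `![false,false,true]` (★ `lastBlockLabel_three`); the proof
runs for a VARIABLE labelling `c` with `c = ![false,false,true]` substituted (`aux`), so no relabelling transport is needed.
* §1 `isOpen_ker_chi`, `isSmooth_leviDatum` (the Levi datum `τ = (σ ∘ ev_false) ⊗ (χ′ ∘ det ∘ ev_true)` is smooth);
* §2 `aux` (variable labelling) and the HEAD **`splitInducedIrreducible_of_principalSeries`**.
Consumer: R90-C10-p02 (road β: GL₂ dichotomy + assembly of S1#7); companion ★ (E3-1) `R90S1SplitInducedIrreducibleOfSupercuspidal`.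

HONEST LABEL: HC_CM is proved only modulo the 7 printed citations (2 remaining named inputs: hLiu418 = stmt-HodgeConjecture-24832, h413 =
stmt-HodgeConjecture-24833) until rung 0 closes; count-neutral helper, closes no socket by itself.

## References
* [BernsteinZelevinsky1977] I. N. Bernstein, A. V. Zelevinsky, *Induced representations of reductive p-adic groups I*, Ann. Sci. ÉNS 10 (1977), Prop. 1.9 (c), §2.3, Thm. 4.2.
* [Zelevinsky1980] A. V. Zelevinsky, *Induced representations of reductive p-adic groups II*, Ann. Sci. ÉNS 13 (1980), Thm. 4.2 p. 184.
* [Rogawski1990] J. D. Rogawski, *Automorphic Representations of Unitary Groups in Three Variables*, Annals of Math. Studies 123 (1990), §4.13 p. 64, §13.3 p. 201.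
-/

set_option autoImplicit false
-- the mandated namespace repeats `HodgeConjecture.HodgeConjecture`, as in every `Theorems/*.lean` of this sub-problem
set_option linter.dupNamespace false

noncomputable section

open Representation Function Literature.NumberTheory.Automorphic Literature.NumberTheory.Automorphic.Zelevinsky1980
open Literature.NumberTheory.GaloisRepresentations.IsNonarchimedeanLocalField
open scoped MatrixGroups

namespace Summit.HodgeConjecture.HodgeConjecture.Cruxes.H413.R90S1SplitInducedIrreducibleOfPrincipalSeries

variable {F : Type} [Field F] [ValuativeRel F] [TopologicalSpace F] [IsNonarchimedeanLocalField F]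

/-! ## §1 The Levi datum is smooth -/

/-- The character `χ′ ∘ det ∘ ev_true` of the Levi (any `Bool`-labelling `c`) has open kernel when `χ′` is continuous. [cite: BushnellHenniart2006, §1.1] -/
theorem isOpen_ker_chi (c : Fin 3 → Bool) (χ' : Fˣ →* ℂˣ) (hχ'c : Continuous fun x => ((χ' x : ℂˣ) : ℂ)) :
    IsOpen (((χ'.comp (Matrix.GeneralLinearGroup.det.comp (Pi.evalMonoidHom (fun a : Bool => GL {i : Fin 3 // c i = a} F) true)))).ker : Set (Π a : Bool, GL {i : Fin 3 // c i = a} F)) := by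
  haveI : IsTopologicalRing F := inferInstance
  have hker : (((χ'.comp (Matrix.GeneralLinearGroup.det.comp (Pi.evalMonoidHom (fun a : Bool => GL {i : Fin 3 // c i = a} F) true)))).ker : Set (Π a : Bool, GL {i : Fin 3 // c i = a} F)) =
      (fun m : (Π a : Bool, GL {i : Fin 3 // c i = a} F) => Matrix.GeneralLinearGroup.det (m true)) ⁻¹' ((χ'.ker : Subgroup Fˣ) : Set Fˣ) := by
    ext m
    simp only [SetLike.mem_coe, MonoidHom.mem_ker, Set.mem_preimage, MonoidHom.comp_apply, Pi.evalMonoidHom_apply]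
  rw [hker]
  exact (Liu2021.SplitPlace.isOpen_ker_of_continuous χ' hχ'c).preimage (Matrix.GeneralLinearGroup.continuous_det.comp (continuous_apply true))

/-- **The Levi datum `τ = (σ ∘ ev_false) ⊗ (χ′ ∘ det ∘ ev_true)` is smooth** for `σ` smooth and `χ′` continuous (any `Bool`-labelling `c`). [cite: BernsteinZelevinsky1977, §2.3] -/
theorem isSmooth_leviDatum (c : Fin 3 → Bool) {W : Type} [AddCommGroup W] [Module ℂ W] (σ : Representation ℂ (GL {i : Fin 3 // c i = false} F) W) (hσs : σ.IsSmooth)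
    (χ' : Fˣ →* ℂˣ) (hχ'c : Continuous fun x => ((χ' x : ℂˣ) : ℂ)) : (Representation.twist (σ.comp (Pi.evalMonoidHom (fun a : Bool => GL {i : Fin 3 // c i = a} F) false)) (χ'.comp (Matrix.GeneralLinearGroup.det.comp (Pi.evalMonoidHom (fun a : Bool => GL {i : Fin 3 // c i = a} F) true)))).IsSmooth := by
  haveI : IsTopologicalRing F := inferInstance
  have hcev : Continuous (fun m : (Π a : Bool, GL {i : Fin 3 // c i = a} F) => (Pi.evalMonoidHom (fun a : Bool => GL {i : Fin 3 // c i = a} F) false) m) := continuous_apply false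
  exact (IsSmooth.comp_of_continuous σ (Pi.evalMonoidHom (fun a : Bool => GL {i : Fin 3 // c i = a} F) false) hcev hσs).twist (isOpen_ker_chi c χ' hχ'c)

/-! ## §2 The principal-series case of S1#7 -/

set_option maxHeartbeats 1600000 in  -- cumulative budget of the declaration over large induced-module terms
/-- **The Levi-level intertwining bijection `τ → box`**: an equivalence `σ ≃ I₂(ψ₁,ψ₂) ∘ (reindexGL e)⁻¹` is, on the same space, a bijective intertwining map from
`τ = (σ ∘ ev_false) ⊗ (χ′∘det∘ev_true)` to ★ E2-I's datum `((I₂ ∘ (reindexGL e)⁻¹) ∘ ev_false) ⊗ ((χ′∘det)∘ev_true)`. [cite: BernsteinZelevinsky1977, §2.3] -/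
theorem exists_bijective_leviMap {W : Type} [AddCommGroup W] [Module ℂ W] (σ : Representation ℂ (GL {i : Fin 3 // (![false, false, true] : Fin 3 → Bool) i = false} F) W) (χ' : Fˣ →* ℂˣ)
    (e : Fin 2 ≃ {i : Fin 3 // (![false, false, true] : Fin 3 → Bool) i = false}) (ψ₁ ψ₂ : Fˣ →* ℂˣ) (eσ : σ.Equiv ((Representation.parabolicIndGL F (id : Fin 2 → Fin 2) ((Representation.trivial ℂ (Π a : Fin 2, GL {i : Fin 2 // (id : Fin 2 → Fin 2) i = a} F) ℂ).twist (∏ a : Fin 2, ((![ψ₁, ψ₂] : Fin 2 → (Fˣ →* ℂˣ)) a).comp (Matrix.GeneralLinearGroup.det.comp (Pi.evalMonoidHom (fun a : Fin 2 => GL {i : Fin 2 // (id : Fin 2 → Fin 2) i = a} F) a))))).comp (reindexGL e).symm.toMonoidHom)) :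
    ∃ φ : (Representation.twist (σ.comp (Pi.evalMonoidHom (fun a : Bool => GL {i : Fin 3 // (![false, false, true] : Fin 3 → Bool) i = a} F) false)) (χ'.comp (Matrix.GeneralLinearGroup.det.comp (Pi.evalMonoidHom (fun a : Bool => GL {i : Fin 3 // (![false, false, true] : Fin 3 → Bool) i = a} F) true)))).IntertwiningMap
      (Representation.twist (((Representation.parabolicIndGL F (id : Fin 2 → Fin 2) ((Representation.trivial ℂ (Π a : Fin 2, GL {i : Fin 2 // (id : Fin 2 → Fin 2) i = a} F) ℂ).twist (∏ a : Fin 2, ((![ψ₁, ψ₂] : Fin 2 → (Fˣ →* ℂˣ)) a).comp (Matrix.GeneralLinearGroup.det.comp (Pi.evalMonoidHom (fun a : Fin 2 => GL {i : Fin 2 // (id : Fin 2 → Fin 2) i = a} F) a))))).comp (reindexGL e).symm.toMonoidHom).comp (Pi.evalMonoidHom (fun a : Bool => GL {i : Fin 3 // (![false, false, true] : Fin 3 → Bool) i = a} F) false)) ((χ'.comp Matrix.GeneralLinearGroup.det).comp (Pi.evalMonoidHom (fun a : Bool => GL {i : Fin 3 // (![false, false, true] : Fin 3 → Bool) i = a}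 F) true))), Function.Bijective φ := by
  obtain ⟨φ, hφ⟩ : ∃ φ : (Representation.twist (σ.comp (Pi.evalMonoidHom (fun a : Bool => GL {i : Fin 3 // (![false, false, true] : Fin 3 → Bool) i = a} F) false)) (χ'.comp (Matrix.GeneralLinearGroup.det.comp (Pi.evalMonoidHom (fun a : Bool => GL {i : Fin 3 // (![false, false, true] : Fin 3 → Bool) i = a} F) true)))).IntertwiningMap
      (Representation.twist (((Representation.parabolicIndGL F (id : Fin 2 → Fin 2) ((Representation.trivial ℂ (Π a : Fin 2, GL {i : Fin 2 // (id : Fin 2 → Fin 2) i = a} F) ℂ).twist (∏ a : Fin 2, ((![ψ₁, ψ₂] : Fin 2 → (Fˣ →* ℂˣ)) a).comp (Matrix.GeneralLinearGroup.det.comp (Pi.evalMonoidHom (fun a : Fin 2 => GL {i : Fin 2 // (id : Fin 2 → Fin 2) i = a} F) a))))).comp (reindexGL e).symm.toMonoidHom).comp (Pi.evalMonoidHom (fun a : Bool => GL {i : Fin 3 // (![false, false, true] : Fin 3 → Bool) i = a} F) false)) ((χ'.comp Matrix.GeneralLinearGroup.det).comp (Pi.evalMonoidHom (fun a : Bool =>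 GL {i : Fin 3 // (![false, false, true] : Fin 3 → Bool) i = a} F) true))), ∀ v, φ v = eσ v := by
    refine ⟨{ toLinearMap := eσ.toLinearEquiv.toLinearMap, isIntertwining' := fun m => LinearMap.ext fun v => ?_ }, fun v => rfl⟩
    change eσ ((Representation.twist (σ.comp (Pi.evalMonoidHom (fun a : Bool => GL {i : Fin 3 // (![false, false, true] : Fin 3 → Bool) i = a} F) false)) (χ'.comp (Matrix.GeneralLinearGroup.det.comp (Pi.evalMonoidHom (fun a : Bool => GL {i : Fin 3 // (![false, false, true] : Fin 3 → Bool) i = a} F) true)))) m v) = (Representation.twist (((Representation.parabolicIndGL F (id : Fin 2 → Fin 2) ((Representation.trivial ℂ (Π a : Fin 2, GL {i : Fin 2 // (id : Fin 2 → Fin 2) i = a} F) ℂ).twist (∏ a : Fin 2, ((![ψ₁, ψ₂] : Fin 2 → (Fˣ →* ℂˣ)) a).comp (Matrix.GeneralLinearGroup.det.comp (Pi.evalMonoidHom (fun a : Fin 2 => GL {i : Fin 2 // (id : Fin 2 → Fin 2) i = a} F) a))))).comp (reindexGL e).symm.toMonoidHom).comp (Pi.evalMonoidHom (fun a : Bool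 => GL {i : Fin 3 // (![false, false, true] : Fin 3 → Bool) i = a} F) false)) ((χ'.comp Matrix.GeneralLinearGroup.det).comp (Pi.evalMonoidHom (fun a : Bool => GL {i : Fin 3 // (![false, false, true] : Fin 3 → Bool) i = a} F) true))) m (eσ v)
    rw [Representation.twist_apply, Representation.twist_apply, map_smul]
    have h1 : eσ ((σ.comp (Pi.evalMonoidHom (fun a : Bool => GL {i : Fin 3 // (![false, false, true] : Fin 3 → Bool) i = a} F) false)) m v) = (((Representation.parabolicIndGL F (id : Fin 2 → Fin 2) ((Representation.trivial ℂ (Π a : Fin 2, GL {i : Fin 2 // (id : Fin 2 → Fin 2) i = a} F) ℂ).twist (∏ a : Fin 2, ((![ψ₁, ψ₂] : Fin 2 → (Fˣ →* ℂˣ)) a).comp (Matrix.GeneralLinearGroup.det.comp (Pi.evalMonoidHom (fun a : Fin 2 => GL {i : Fin 2 // (id : Fin 2 → Fin 2) i = a} F) a))))).comp (reindexGL e).symm.toMonoidHom).comp (Pi.evalMonoidHom (fun a : Bool => GL {i : Fin 3 // (![false, false, true] : Fin 3 → Bool) i = a} F) false)) m (eσ v) :=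
      Representation.IntertwiningMap.isIntertwining _ _ eσ.toIntertwiningMap (m false) v
    rw [h1]
    rfl
  refine ⟨φ, fun a b hab => ?_, fun w => ⟨eσ.symm w, ?_⟩⟩
  · rw [hφ, hφ] at hab
    exact eσ.toLinearEquiv.injective hab
  · rw [hφ]
    exact eσ.apply_symm_apply w

set_option maxHeartbeats 1600000 in  -- cumulative budget of the declaration over large induced-module terms
/-- **`I(ψ₁, ψ₂, χ′)` is irreducible when no two letters are linked**: ★ C0-IRR (not all equal; the weak 3-cell lemma `h3`) or ★ IH-5 (all equal).
[cite: Zelevinsky1980, Thm. 4.2 p. 184] [cite: BernsteinZelevinsky1977, Thm. 4.2] -/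
theorem isIrreducible_principalSeries_three
    (h3 : ∀ (χ : (Π a : Fin 3, GL {i : Fin 3 // (id : Fin 3 → Fin 3) i = a} F) →* ℂˣ),
      ∀ c : Fin 3 → Fin 2, Monotone c → Function.Surjective c →
        ∀ (W : Type) [AddCommGroup W] [Module ℂ W] (σ : Representation ℂ (Π a : Fin 2, GL {i : Fin 3 // c i = a} F) W),
          σ.IsIrreducible → σ.IsSmooth → σ.IsSupercuspidal →
          ∀ (N : Subrepresentation (Representation.jacquetGL F c (Representation.parabolicIndGL F (id : Fin 3 → Fin 3)
              ((Representation.trivial ℂ (Π a : Fin 3, GL {i : Fin 3 // (id : Fin 3 → Fin 3) i = a} F) ℂ).twist χ))))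
            (q : N.toRepresentation.IntertwiningMap σ), q = 0)
    (ψ₁ ψ₂ χ' : Fˣ →* ℂˣ) (hψ₁ : IsOpen ((ψ₁.ker : Subgroup Fˣ) : Set Fˣ)) (hψ₂ : IsOpen ((ψ₂.ker : Subgroup Fˣ) : Set Fˣ)) (hχ' : IsOpen ((χ'.ker : Subgroup Fˣ) : Set Fˣ))
    (hunl : ∀ i j : Fin 3, i ≠ j → (![ψ₁, ψ₂, χ'] : Fin 3 → (Fˣ →* ℂˣ)) j ≠ (![ψ₁, ψ₂, χ'] : Fin 3 → (Fˣ →* ℂˣ)) i * ((unramifiedTwist F 1 : QuasiChar F).toMonoidHom)) :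
    (Representation.parabolicIndGL F (id : Fin 3 → Fin 3) ((Representation.trivial ℂ (Π a : Fin 3, GL {i : Fin 3 // (id : Fin 3 → Fin 3) i = a} F) ℂ).twist (∏ a : Fin 3, ((![ψ₁, ψ₂, χ'] : Fin 3 → (Fˣ →* ℂˣ)) a).comp (Matrix.GeneralLinearGroup.det.comp (Pi.evalMonoidHom (fun a : Fin 3 => GL {i : Fin 3 // (id : Fin 3 → Fin 3) i = a} F) a))))).IsIrreducible := by
  have hθ : ∀ a : Fin 3, IsOpen ((((![ψ₁, ψ₂, χ'] : Fin 3 → (Fˣ →* ℂˣ)) a).ker : Subgroup Fˣ) : Set Fˣ) := fun a => by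
    fin_cases a
    · exact hψ₁
    · exact hψ₂
    · exact hχ'
  by_cases hne : (![ψ₁, ψ₂, χ'] : Fin 3 → (Fˣ →* ℂˣ)) 0 = (![ψ₁, ψ₂, χ'] : Fin 3 → (Fˣ →* ℂˣ)) 1 ∧ (![ψ₁, ψ₂, χ'] : Fin 3 → (Fˣ →* ℂˣ)) 1 = (![ψ₁, ψ₂, χ'] : Fin 3 → (Fˣ →* ℂˣ)) 2
  · -- all three letters equal: ★ IH-5
    have h01 : ψ₂ = ψ₁ := by
      have h := hne.1
      simp only [Matrix.cons_val_zero, Matrix.cons_val_one] at h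
      exact h.symm
    have h12 : χ' = ψ₁ := by
      have h := hne.2
      simp only [Matrix.cons_val_one, Matrix.head_cons, Matrix.cons_val_two, Matrix.tail_cons] at h
      exact h.symm.trans h01
    rw [h01, h12]
    exact K2E3GL3UnitaryPrincipalSeriesIrregular.isIrreducible_parabolicIndGL_id_three_self ψ₁ hψ₁
  · exact K2E3GL3PrincipalSeriesIrreducibleUnlinked.isIrreducible_principalSeries_three_of_unlinked (![ψ₁, ψ₂, χ'] : Fin 3 → (Fˣ →* ℂˣ)) hθ (h3 _) hunl hne

set_option maxHeartbeats 1600000 in  -- cumulative budget of the declaration over large induced-module terms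
/-- **AUXILIARY (variable labelling `c = ![false,false,true]`)**: `Ind_{P_c}(τ)` is irreducible for `σ ≅ I₂(ψ₁,ψ₂) ∘ (reindexGL e)⁻¹` with no two of `ψ₁, ψ₂, χ′` linked —
induction in stages ★ E2-I transported along the bijection of `exists_bijective_leviMap` by the exact functor `i_c` (★ `parabolicIndGLMap_injective ∕ _surjective`), then
`isIrreducible_principalSeries_three`. [cite: BernsteinZelevinsky1977, Prop. 1.9 (c), §2.3, Thm. 4.2] [cite: Zelevinsky1980, Thm. 4.2 p. 184] -/
theorem aux (c : Fin 3 → Bool) (hc : c = (![false, false, true] : Fin 3 → Bool))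
    (h3 : ∀ (χ : (Π a : Fin 3, GL {i : Fin 3 // (id : Fin 3 → Fin 3) i = a} F) →* ℂˣ),
      ∀ c : Fin 3 → Fin 2, Monotone c → Function.Surjective c →
        ∀ (W : Type) [AddCommGroup W] [Module ℂ W] (σ : Representation ℂ (Π a : Fin 2, GL {i : Fin 3 // c i = a} F) W),
          σ.IsIrreducible → σ.IsSmooth → σ.IsSupercuspidal →
          ∀ (N : Subrepresentation (Representation.jacquetGL F c (Representation.parabolicIndGL F (id : Fin 3 → Fin 3)
              ((Representation.trivial ℂ (Π a : Fin 3, GL {i : Fin 3 // (id : Fin 3 → Fin 3) i = a} F) ℂ).twist χ))))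
            (q : N.toRepresentation.IntertwiningMap σ), q = 0)
    {W : Type} [AddCommGroup W] [Module ℂ W] (σ : Representation ℂ (GL {i : Fin 3 // c i = false} F) W) (hσs : σ.IsSmooth)
    (χ' : Fˣ →* ℂˣ) (hχ'c : Continuous fun x => ((χ' x : ℂˣ) : ℂ))
    (e : Fin 2 ≃ {i : Fin 3 // c i = false}) (he : ∀ j : Fin 2, ((e j : {i : Fin 3 // c i = false}) : Fin 3) = Fin.castSucc j)
    (ψ₁ ψ₂ : Fˣ →* ℂˣ) (hψ₁ : IsOpen ((ψ₁.ker : Subgroup Fˣ) : Set Fˣ)) (hψ₂ : IsOpen ((ψ₂.ker : Subgroup Fˣ) : Set Fˣ))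
    (eσ : σ.Equiv ((Representation.parabolicIndGL F (id : Fin 2 → Fin 2) ((Representation.trivial ℂ (Π a : Fin 2, GL {i : Fin 2 // (id : Fin 2 → Fin 2) i = a} F) ℂ).twist (∏ a : Fin 2, ((![ψ₁, ψ₂] : Fin 2 → (Fˣ →* ℂˣ)) a).comp (Matrix.GeneralLinearGroup.det.comp (Pi.evalMonoidHom (fun a : Fin 2 => GL {i : Fin 2 // (id : Fin 2 → Fin 2) i = a} F) a))))).comp (reindexGL e).symm.toMonoidHom))
    (hunl : ∀ i j : Fin 3, i ≠ j → (![ψ₁, ψ₂, χ'] : Fin 3 → (Fˣ →* ℂˣ)) j ≠ (![ψ₁, ψ₂, χ'] : Fin 3 → (Fˣ →* ℂˣ)) i * ((unramifiedTwist F 1 : QuasiChar F).toMonoidHom)) :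
    (Representation.parabolicIndGL F c (Representation.twist (σ.comp (Pi.evalMonoidHom (fun a : Bool => GL {i : Fin 3 // c i = a} F) false)) (χ'.comp (Matrix.GeneralLinearGroup.det.comp (Pi.evalMonoidHom (fun a : Bool => GL {i : Fin 3 // c i = a} F) true))))).IsIrreducible := by
  subst hc
  have hτsm : (Representation.twist (σ.comp (Pi.evalMonoidHom (fun a : Bool => GL {i : Fin 3 // (![false, false, true] : Fin 3 → Bool) i = a} F) false)) (χ'.comp (Matrix.GeneralLinearGroup.det.comp (Pi.evalMonoidHom (fun a : Bool => GL {i : Fin 3 // (![false, false, true] : Fin 3 → Bool) i = a} F) true)))).IsSmooth := isSmooth_leviDatum (![false, false, true] : Fin 3 → Bool) σ hσs χ' hχ'c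
  obtain ⟨φ, hinj, hsurj⟩ := exists_bijective_leviMap σ χ' e ψ₁ ψ₂ eσ
  have E₁ := Representation.IntertwiningMap.ofBijective (parabolicIndGLMap F (![false, false, true] : Fin 3 → Bool) φ)
    ⟨parabolicIndGLMap_injective F (![false, false, true] : Fin 3 → Bool) hinj, parabolicIndGLMap_surjective F (![false, false, true] : Fin 3 → Bool) hτsm hsurj⟩
  obtain ⟨E₂, -⟩ := K2E3GL3InductionInStagesEquiv.exists_equiv_parabolicIndGL_twoOne_box e he ψ₁ ψ₂ χ'
  exact (Representation.Equiv.isIrreducible_iff (E₁.trans E₂)).2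
    (isIrreducible_principalSeries_three h3 ψ₁ ψ₂ χ' hψ₁ hψ₂ (Liu2021.SplitPlace.isOpen_ker_of_continuous χ' hχ'c) hunl)

/-- **`n-Ind_{P(2,1)}^{GL₃(F)}(σ ⊠ χ′)` IS IRREDUCIBLE FOR `σ` AN IRREDUCIBLE PRINCIPAL SERIES WITH NO LINKS** — socket S1#7's body (binders `_hσi … _hχ'c` VERBATIM, `[CharZero F]` added) with the
HYPOTHESIS-FIRST principal-series datum: `e`, `he`, `ψ₁ ψ₂` with open kernels, `σ ≃ I₂(ψ₁,ψ₂) ∘ (reindexGL e)⁻¹` (★ E2-I box currency) and the «no link» letters (★ C0-IRR's `hunl` shape).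
(The weak 3-cell lemma is ★ `K2E3GL3PrincipalSeriesThreeCell.principalSeriesThreeCell`.) [cite: Zelevinsky1980, Thm. 4.2 p. 184] [cite: BernsteinZelevinsky1977, Prop. 1.9 (c), Thm. 4.2] [cite: Rogawski1990, §4.13 p. 64, §13.3 p. 201] -/
theorem splitInducedIrreducible_of_principalSeries :
    ∀ (F : Type) [Field F] [ValuativeRel F] [TopologicalSpace F] [IsNonarchimedeanLocalField F] [CharZero F]
      [LocallyCompactSpace ↥(standardParabolicGL F (Zelevinsky1980.lastBlockLabel 3))]
      (W : Type) [AddCommGroup W] [Module ℂ W]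
      (σ : Representation ℂ (GL {i : Fin 3 // Zelevinsky1980.lastBlockLabel 3 i = false} F) W)
      (_hσi : σ.IsIrreducible) (_hσs : σ.IsSmooth) (_hσa : σ.IsAdmissible) (_hσu : σ.IsUnitarizable)
      (χ' : Fˣ →* ℂˣ) (_hχ'u : ∀ x, ‖((χ' x : ℂˣ) : ℂ)‖ = 1) (_hχ'c : Continuous fun x => ((χ' x : ℂˣ) : ℂ))
      (e : Fin 2 ≃ {i : Fin 3 // Zelevinsky1980.lastBlockLabel 3 i = false}) (_he : ∀ j : Fin 2, ((e j : {i : Fin 3 // Zelevinsky1980.lastBlockLabel 3 i = false}) : Fin 3) = Fin.castSucc j)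
      (ψ₁ ψ₂ : Fˣ →* ℂˣ) (_hψ₁ : IsOpen ((ψ₁.ker : Subgroup Fˣ) : Set Fˣ)) (_hψ₂ : IsOpen ((ψ₂.ker : Subgroup Fˣ) : Set Fˣ))
      (_eσ : σ.Equiv ((Representation.parabolicIndGL F (id : Fin 2 → Fin 2) ((Representation.trivial ℂ (Π a : Fin 2, GL {i : Fin 2 // (id : Fin 2 → Fin 2) i = a} F) ℂ).twist (∏ a : Fin 2, ((![ψ₁, ψ₂] : Fin 2 → (Fˣ →* ℂˣ)) a).comp (Matrix.GeneralLinearGroup.det.comp (Pi.evalMonoidHom (fun a : Fin 2 => GL {i : Fin 2 // (id : Fin 2 → Fin 2) i = a} F) a))))).comp (reindexGL e).symm.toMonoidHom))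
      (_hunl : ∀ i j : Fin 3, i ≠ j → (![ψ₁, ψ₂, χ'] : Fin 3 → (Fˣ →* ℂˣ)) j ≠ (![ψ₁, ψ₂, χ'] : Fin 3 → (Fˣ →* ℂˣ)) i * ((unramifiedTwist F 1 : QuasiChar F).toMonoidHom)),
      (Representation.parabolicIndGL F (Zelevinsky1980.lastBlockLabel 3)
        (Representation.twist
          (σ.comp (Pi.evalMonoidHom (fun a : Bool => GL {i : Fin 3 // Zelevinsky1980.lastBlockLabel 3 i = a} F) false))
          (χ'.comp (Matrix.GeneralLinearGroup.det.comp
            (Pi.evalMonoidHom (fun a : Bool => GL {i : Fin 3 // Zelevinsky1980.lastBlockLabel 3 i = a} F) true))))).IsIrreducible :=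
  fun F _ _ _ _ _ _ _ _ _ σ _ hσs _ _ χ' _ hχ'c e he ψ₁ ψ₂ hψ₁ hψ₂ eσ hunl =>
    aux (lastBlockLabel 3) K2E3GL3MaximalParabolicRelabel.lastBlockLabel_three (K2E3GL3PrincipalSeriesThreeCell.principalSeriesThreeCell F)
      σ hσs χ' hχ'c e he ψ₁ ψ₂ hψ₁ hψ₂ eσ hunl

end Summit.HodgeConjecture.HodgeConjecture.Cruxes.H413.R90S1SplitInducedIrreducibleOfPrincipalSeries

end
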